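import Literature.IUT.HodgeTheaters.PuncturedEllipticCoveringsCor12UniqueDoubleCover
import Literature.IUT.HodgeTheaters.PuncturedEllipticCoveringsCor12InertiaOfCommutatorCusp
import HarnessLib

/-!
# [IUTchI] Cor. 1.2 — abc-iut-L5-t1's torsion-generated closer with the law `hIH′` derived from the commutator
# description of the cusp inertia (rows R1 ∘ «huniq» ∘ R2 composed) — proof-only

Mochizuki, *Inter-universal Teichmüller theory I*, kurims manuscript (May 2020), §1, pp. 37–39, Corollary 1.2
p. 39 ([IUTchI] §1 pp.37–39) [claim: Mochizuki2012, status: disputed]; classical input [AbsTopI] Lemma 4.5 (i)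
p. 54 (`Δ` of a once-punctured curve free pro-`Σ`, cusp inertia the conjugates of `⟨[a, b]⟩⁻`)
[cite: MochizukiAbsTopI2012, Lemma 4.5 (i) p.54].  Node `IUTchI:Cor1.2` (plan/L5/SUBDAG-IUTchI-Cor12.md);
cell abc-iut, seat abc-iut-f-090 (gen 8), second sequel of row «COR12-INERTIA-COMMUTATOR» (p491462
`…Cor12InertiaOfCommutatorCusp.lean`; first sequel p493184/p494126 `…Cor12OfFreeProCommutatorCusp.lean`, which
is at the 400-line cap — hence this separate file).  PROOF-ONLY companion (no definitions, no instances, no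
notation, nothing restated) over abc-iut-L5-t1's `…Cor12UniqueDoubleCover.lean` (closer
`InitialThetaData.pe_characteristicNatureOfCoverings_viaX_of_freePro_torsionGenerated`: print-faithful
torsion-freeness of `Δ_X` from (A), `huniq` DISCHARGED from the origin law `hgenC′` "`Δ′_C` is topologically
generated by its torsion" + (A), `hrank′` discharged and `hΔ hΔ′` derived from (A)).

WHAT THIS FILE DOES.  One theorem: `InitialThetaData.pe_characteristicNatureOfCoverings_viaX_of_freePro_torsionGenerated_commutatorCusp`
= that closer with `hIH′` ("every cusp inertia group of `X̲′` lies in `H′ = Ker(Δ′_X ↠ Δ′_X^{ab} ⊗ ℤ/l′)`")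
supplied by p491462's `PuncturedEllipticData.inertia_le_H_of_commutatorCusp_gens` from the origin datum
  (c′) every cusp inertia group of `X̲′` is the closed procyclic subgroup `⟨g [gens′ 0, gens′ 1] g⁻¹⟩⁻` on a
       `Δ′_X`-conjugate of the commutator of the two free generators (the cusp of `X′_{K′}`).
Displayed binders: DATA `C C′ A`; origin-shaped `hfree hfree′` (A), `hgenC′`, `hcusp′` (c′); LAW `hL L′`
(abc-iut-L5-t1's `ModLCuspLaws`), `h0 h0′` (GAP G-L5d4g6-1), `hext hextC` ([AbsTopII] Cor. 3.3 (i) extension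
form — the L4 adapter row R3), `hA hA′` (F-0206 instances) — 8.

HONEST FRAMING: nothing here asserts that abc is proved or refuted or takes a side on [IUTchIII] Cor. 3.12;
(A), (c′), `hgenC′` are assumption labels (origin data of the étale fundamental groups of `X_K`, `X_{K′}`,
`C_{K′}`), never asserted; a law derived from displayed origin data is not a token flip; typed ≠ inhabited ≠
discharged; no printed statement is strengthened.
-/

namespace Literature.IUT.HodgeTheaters

namespace InitialThetaData

open scoped Pointwise
open Literature.AnabelianGeometry.AbsoluteAnabelian
open Literature.AnabelianGeometry.AbsoluteAnabelian.FundamentalExtension (CuspidalAlgorithm)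

universe u u'

variable {F : Type u} {K : Type} {Fbar : Type} [Field F] [NumberField F] [Field K] [NumberField K]
  [Algebra F K] [Field Fbar] [Algebra F Fbar] [Algebra K Fbar]
  {E : WeierstrassCurve F} [E.IsElliptic] {l : ℕ} {Pb : BadPlacePredicates K}
  (D : InitialThetaData F K Fbar E l Pb)
  {F' : Type u'} {K' : Type} [Field F'] [NumberField F'] [Field K'] [NumberField K'] [Algebra F' K']
  {Fbar' : Type} [Field Fbar'] [Algebra F' Fbar'] [Algebra K' Fbar']
  {E' : WeierstrassCurve F'} [E'.IsElliptic] {l' : ℕ} {Pb' : BadPlacePredicates K'}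
  (D' : InitialThetaData F' K' Fbar' E' l' Pb')

/-- **[IUTchI] Cor. 1.2 between the `K`-level data of two initial Θ-data — abc-iut-L5-t1's closer
`pe_characteristicNatureOfCoverings_viaX_of_freePro_torsionGenerated` with the law `hIH′` ALSO DERIVED from the
origin datum (c′)** («every cusp inertia group of `X̲′` is `⟨g [gens′ 0, gens′ 1] g⁻¹⟩⁻`, `g ∈ Δ′_X`»,
[AbsTopI] Lem. 4.5 (i) at `X_{K′}`; `PuncturedEllipticData.inertia_le_H_of_commutatorCusp_gens`, p491462).
Remaining LAW binders: `hL L′` (`ModLCuspLaws`), `h0 h0′` (GAP G-L5d4g6-1), `hext hextC` ([AbsTopII] Cor. 3.3 (i)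
extension form), `hA hA′` (F-0206 instances) — 8; origin-shaped `hfree hfree′` (A), `hgenC′` (torsion
generation of `Δ′_C`), `hcusp′` (c′); DATA `C C′ A`. ([IUTchI] Cor 1.2 p.39) [claim: Mochizuki2012, status:
disputed] -/
theorem pe_characteristicNatureOfCoverings_viaX_of_freePro_torsionGenerated_commutatorCusp
    (C : D.geom.pe.CuspGalois) (C' : D'.geom.pe.CuspGalois)
    (hL : D.geom.pe.ModLCuspLaws) (L' : D'.geom.pe.ModLCuspLaws)
    {gens : Fin 2 → ↥(D.geom.pe.PiX ⊓ D.geom.pe.DeltaC)}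
    (hfree : IsFreeProOn ↥(D.geom.pe.PiX ⊓ D.geom.pe.DeltaC) Set.univ gens)
    {gens' : Fin 2 → ↥(D'.geom.pe.PiX ⊓ D'.geom.pe.DeltaC)}
    (hfree' : IsFreeProOn ↥(D'.geom.pe.PiX ⊓ D'.geom.pe.DeltaC) Set.univ gens')
    (hgenC' : D'.geom.pe.DeltaC ≤ (Subgroup.closure
      {g : D'.geom.pe.PiC | g ∈ D'.geom.pe.DeltaC ∧ IsOfFinOrder g}).topologicalClosure)
    (hcusp' : ∀ x : D'.geom.pe.Cusp, ∃ g ∈ D'.geom.pe.PiX ⊓ D'.geom.pe.DeltaC,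
      D'.geom.pe.inertia x = (Subgroup.zpowers (g * ((gens' 0 : D'.geom.pe.PiC) * (gens' 1 : D'.geom.pe.PiC) *
        (gens' 0 : D'.geom.pe.PiC)⁻¹ * (gens' 1 : D'.geom.pe.PiC)⁻¹) * g⁻¹)).topologicalClosure)
    (h0 : ¬ D.geom.pe.inertia D.geom.pe.ε0 ≤ D.geom.pe.piXarrow)
    (h0' : ¬ D'.geom.pe.inertia D'.geom.pe.ε0 ≤ D'.geom.pe.piXarrow)
    (hext : ∀ φ : D.geom.pe.piXarrow ≃* D'.geom.pe.piXarrow, Continuous φ → Continuous φ.symm →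
      ∃ Θ : D.geom.pe.PiC ≃ₜ* D'.geom.pe.PiC,
        ∀ x : D.geom.pe.piXarrow, Θ (x : D.geom.pe.PiC) = (φ x : D'.geom.pe.PiC))
    (hextC : ∀ ψ : D.geom.pe.piCarrow ≃* D'.geom.pe.piCarrow, Continuous ψ → Continuous ψ.symm →
      ∃ Θ : D.geom.pe.PiC ≃ₜ* D'.geom.pe.PiC,
        ∀ x : D.geom.pe.piCarrow, Θ (x : D.geom.pe.PiC) = (ψ x : D'.geom.pe.PiC))
    (A : CuspidalAlgorithm.{0}) (hA : A.RecoversCusps D.geom.pe.extXbar C.cuspidalDataXbar)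
    (hA' : A.RecoversCusps D'.geom.pe.extXbar C'.cuspidalDataXbar) :
    D.geom.pe.CharacteristicNatureOfCoverings D'.geom.pe :=
  D.pe_characteristicNatureOfCoverings_viaX_of_freePro_torsionGenerated D' C C' hL L' hfree hfree' hgenC' h0 h0'
    hext hextC A hA hA' (D'.geom.pe.inertia_le_H_of_commutatorCusp_gens gens' hcusp')

end InitialThetaData

end Literature.IUT.HodgeTheaters
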